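import Mathlib.FieldTheory.Galois.Basic
import Mathlib.Topology.Algebra.Valued.NormedValued
import Mathlib.RingTheory.Valuation.Integral
import Summits.ABC.IUTFork.Joshi.RosettaFragment1
import HarnessLib

/-!
# [J-III] §8.2.5 / Prop. 8.3.1.1 (1) / Prop. 8.3.2.1 (3): two PROVED bridges for Rosetta Stone Fragment 1

Proof-only sequel (no new definitions) of `Summits/ABC/IUTFork/Joshi/RosettaFragment1.lean` (abc-iut-E-t16, slot T-16;
K. Joshi, arXiv:2401.13508v4 §8, bib `Joshi2024ATS3`, UNREFEREED, claim status `disputed`; typed ≠ proved ≠ endorsed;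
no side taken on [IUTchIII] Cor. 3.12 or on any author). It discharges two DERIVABLE rows of
`HOME/plan/E/t16/INVENTORY.tsv` / `ROSETTA-DICTIONARY.tsv` that the statement file left as dictionary prose:

1. **«preferred isomorph» ↔ the tree's `G_K`** (§8.2.5 p.75 l.22–24 «the absolute galois group of `L_v` computed for
   the algebraic closure of `L_v` in `K_v`»; Prop. 8.3.1.1 (1) p.76 l.9–10 «preferred isomorph `G_{L_v;K_v} ≃ G_{L_v}`»):
   for a `p`-adic field given, as in the tree's [SemiAnbd] §6 interface `TemperedAnabelian.TemperedCurve` and in E-t1's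
   `ATSObj`, as an intermediate field `K` of a FIXED algebraic closure `E/F`, Joshi's `G_{K;K_v} = Gal(K̄_{;K_v}/K)`
   (`Rosetta.PrefGal K K_v`, the Galois group of the algebraic closure of `K` INSIDE the untilt `K_v`) is isomorphic to
   Mochizuki's `G_K = ` the fixing subgroup of `K` in `Gal(E/F)` (`nonempty_prefGal_mulEquiv_fixingSubgroup`), hence
   to the image `G_K` of the augmentation `Π^temp_X → G_{ℚ_p}` of any `TemperedCurve` with base field `K`
   (`nonempty_prefGal_mulEquiv_range_aug`, via `TemperedCurve.range_aug`). This is the kernel form of the Fragment 1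
   étale row «corresponding group-like objects are all isomorphic» (p.79 l.19) for the Galois quotients.
2. **`𝒪_{L̄_{v;K_v}} ⊂ 𝒪_{K_v}`** (Fragment 1 Frobenius row p.79 l.52–59 «`G_{L_v;K_v} ↷ 𝒪^*_{L̄_v;K_v} ⊂ 𝒪^*_{K_v}`,
   `↷ 𝒪^⊳_{L̄_v;K_v} ⊂ 𝒪^⊳_{K_v}`»; Prop. 8.3.2.1 (3) p.76 l.34–40 «`𝒪^⊳_{L̄_v} − {0} ⊂ 𝒪^⊳_{K_v} − {0}`»): from the single
   carrier field `LocalHolDatum.norm_algebraMap_le_one_iff` («`ℚ_{p_v}` / `L_v` isometrically embedded», Prop. 8.3.1.1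
   (1)) and the ultrametric inequality of the untilt `K_v` (E-t1's `Untilt`), every element of the ring of integers
   `𝒪_{L̄_{v;K_v}}` (the tree's `integersClosure L_v L̄_{v;K_v}` = integral closure of `𝒪_{L_v}`, [AbsTopIII] Def. 3.1
   (i)) has norm `≤ 1` in `K_v` (`norm_le_one_of_mem_integersClosure`); in particular the monoids `𝒪^⊳`, `𝒪^×` of the
   Frobenius-like pairs `LocalHolDatum.frobeniusLike .TM / .TCG` map into the closed unit ball resp. the unit sphere of
   `K_v` (`norm_le_one_of_mem_nonzeroIntegers`, `norm_eq_one_of_mem_unitSubmonoid`). Tool: Mathlib's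
   `Valuation.Integers.isIntegral_iff_v_le_one` for the norm valuation of `K_v`.
Standard axioms only; sorry-free; nothing of Joshi's text is asserted. bears_on: LADDER-ABC:A2.E.
-/

noncomputable section

open scoped ValuativeRel NNReal

namespace Summit.ABC.IUTFork.Joshi.Rosetta

open Literature.AnabelianGeometry.AbsoluteAnabelian

/-! ## 1. The preferred isomorph `G_{K;K_v}` vs the fixing subgroup `G_K ≤ Gal(E/F)` of a fixed algebraic closure -/

section Galois

variable {F : Type} [Field F] {E : Type} [Field E] [Algebra F E] [IsAlgClosed E] [Algebra.IsAlgebraic F E]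

/-- PROVED: for an intermediate field `K` of a fixed algebraic closure `E ⊇ F` and any algebraically closed `K`-algebra
`K_v`, Joshi's preferred isomorph `G_{K;K_v} = Gal(K̄_{;K_v}/K)` (Prop. 8.3.1.1 (1)) is isomorphic to the fixing
subgroup of `K` in `Gal(E/F)` — Mochizuki's `G_K ⊆ G_F` ([IUTchI] Def. 3.1 (e) «`G_v ⊆ G_K := Gal(F̄/K)`»). -/
theorem nonempty_prefGal_mulEquiv_fixingSubgroup (K : IntermediateField F E) (Kv : Type) [Field Kv] [Algebra K Kv]
    [IsAlgClosed Kv] : Nonempty (PrefGal K Kv ≃* K.fixingSubgroup) := by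
  haveI : IsAlgClosure K E :=
    (isAlgClosure_iff K E).mpr ⟨inferInstance, Algebra.IsAlgebraic.tower_top (K := F) K⟩
  obtain ⟨e⟩ := nonempty_prefGal_mulEquiv (Lv := K) (Kv := Kv) E
  exact ⟨e.trans (IntermediateField.fixingSubgroupEquiv K).symm⟩

/-- PROVED: for a `TemperedCurve X` over the `p`-adic field `X.K ⊆ AlgebraicClosure ℚ_[p]` ([SemiAnbd] §6 interface,
E-t1's `ATSObj.Y`) and any algebraically closed `X.K`-algebra `K_v` (the untilt), Joshi's `G_{K;K_v}` is isomorphic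
to the tree's `G_K =` image of the augmentation `Π^temp_X → G_{ℚ_p}` (`TemperedCurve.range_aug`) — the Galois
quotient of the Fragment 1 étale row «`Π^temp_{X/L_v;K_v} ↠ G_{L_v;K_v}`» vs «`Π_v ↠ G_v`». -/
theorem nonempty_prefGal_mulEquiv_range_aug {p : ℕ} [Fact p.Prime]
    (X : Literature.AnabelianGeometry.SemiGraphs.TemperedCurve p) (Kv : Type) [Field Kv] [Algebra X.K Kv]
    [IsAlgClosed Kv] : Nonempty (PrefGal X.K Kv ≃* X.aug.toMonoidHom.range) := by
  obtain ⟨e⟩ := nonempty_prefGal_mulEquiv_fixingSubgroup (F := ℚ_[p]) (E := AlgebraicClosure ℚ_[p]) X.K Kv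
  exact ⟨e.trans (MulEquiv.subgroupCongr X.range_aug.symm)⟩

end Galois

/-! ## 2. The integers of the preferred algebraic closure lie in the unit ball of the untilt -/

section Integers

variable {p : ℕ} [Fact p.Prime] {Lv : Type} [Field Lv] [ValuativeRel Lv] {U : Untilt p} [Algebra Lv U.K]
  {Γ : Type} [Group Γ] [TopologicalSpace Γ]

/-- PROVED — **`𝒪_{L̄_{v;K_v}} ⊂ 𝒪_{K_v}`** (Fragment 1 Frobenius row, p.79 l.52–59; Prop. 8.3.2.1 (3)): an element of
`L̄_{v;K_v}` integral over `𝒪_{L_v}` has norm `≤ 1` in `K_v`. From `LocalHolDatum.norm_algebraMap_le_one_iff` (the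
embedding `L_v ↪ K_v` is isometric on the unit ball) and the ultrametric inequality in `K_v`, via Mathlib's
`Valuation.Integers.isIntegral_iff_v_le_one` for the norm valuation. -/
theorem norm_le_one_of_mem_integersClosure (H : LocalHolDatum Lv U Γ) {x : PrefAlgClosure Lv U.K}
    (hx : x ∈ integersClosure Lv (PrefAlgClosure Lv U.K)) : ‖(x : U.K)‖ ≤ 1 := by
  classical
  -- the norm valuation of `K_v` and its valuation ring
  let v : Valuation U.K ℝ≥0 := NormedField.valuation
  have hO : v.Integers v.integer := Valuation.integer.integers v
  -- `𝒪_{L_v} → 𝒪_{K_v}` through `L_v ↪ K_v`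
  have hmem : ∀ a : 𝒪[Lv], algebraMap Lv U.K a ∈ v.integer := fun a => by
    change v (algebraMap Lv U.K a) ≤ 1
    have h1 : ‖algebraMap Lv U.K a‖ ≤ 1 := (H.norm_algebraMap_le_one_iff a).mpr a.2
    change ‖algebraMap Lv U.K a‖₊ ≤ 1
    exact_mod_cast h1
  let φ : 𝒪[Lv] →+* v.integer := ((algebraMap Lv U.K).comp (𝒪[Lv]).subtype).codRestrict v.integer hmem
  -- transport integrality along `φ`
  have hint : IsIntegral 𝒪[Lv] x := hx
  obtain ⟨f, hf, hfx⟩ := hint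
  have hint' : IsIntegral v.integer (x : U.K) := by
    refine ⟨f.map φ, hf.map φ, ?_⟩
    rw [Polynomial.eval₂_map]
    have hcomp : (algebraMap v.integer U.K).comp φ =
        (algebraMap (PrefAlgClosure Lv U.K) U.K).comp (algebraMap 𝒪[Lv] (PrefAlgClosure Lv U.K)) := by
      ext a
      change algebraMap Lv U.K (a : Lv) = ((algebraMap 𝒪[Lv] (PrefAlgClosure Lv U.K) a : PrefAlgClosure Lv U.K) : U.K)
      rw [show (algebraMap 𝒪[Lv] (PrefAlgClosure Lv U.K) a) = algebraMap Lv (PrefAlgClosure Lv U.K) (a : Lv) from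
        rfl]
      exact (IsScalarTower.algebraMap_apply Lv (PrefAlgClosure Lv U.K) U.K (a : Lv)).symm ▸ rfl
    rw [hcomp, show (x : U.K) = algebraMap (PrefAlgClosure Lv U.K) U.K x from rfl, ← Polynomial.hom_eval₂, hfx,
      map_zero]
  have hv : v (x : U.K) ≤ 1 := (hO.isIntegral_iff_v_le_one).mp hint'
  have : ‖(x : U.K)‖₊ ≤ 1 := hv
  exact_mod_cast this

/-- PROVED: the monoid `𝒪^⊳_{L̄_{v;K_v}}` of the Frobenius-like `TM`-pair (`LocalHolDatum.frobeniusLike .TM`, the tree's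
`nonzeroIntegers`) maps into the closed unit ball of `K_v` minus `0` («`⊂ 𝒪^⊳_{K_v} − {0}`», Prop. 8.3.2.1 (3)). -/
theorem norm_le_one_of_mem_nonzeroIntegers (H : LocalHolDatum Lv U Γ) {x : PrefAlgClosure Lv U.K}
    (hx : x ∈ nonzeroIntegers Lv (PrefAlgClosure Lv U.K)) : ‖(x : U.K)‖ ≤ 1 ∧ (x : U.K) ≠ 0 :=
  ⟨norm_le_one_of_mem_integersClosure H hx.1, fun h => hx.2 (Subtype.ext h)⟩

/-- PROVED: the group `𝒪^×_{L̄_{v;K_v}}` of the Frobenius-like `TCG`-pair (`unitSubmonoid`) maps into the unit SPHERE of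
`K_v` («`⊂ 𝒪^*_{K_v}`», Fragment 1 p.79 l.52–55): a unit and its inverse both have norm `≤ 1`. -/
theorem norm_eq_one_of_mem_unitSubmonoid (H : LocalHolDatum Lv U Γ) {x : PrefAlgClosure Lv U.K}
    (hx : x ∈ unitSubmonoid Lv (PrefAlgClosure Lv U.K)) : ‖(x : U.K)‖ = 1 := by
  obtain ⟨hxint, y, hyint, hxy⟩ := hx
  have hx1 := norm_le_one_of_mem_integersClosure H hxint
  have hy1 := norm_le_one_of_mem_integersClosure H hyint
  have hprod : ‖(x : U.K)‖ * ‖(y : U.K)‖ = 1 := by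
    rw [← norm_mul]
    have := congrArg (fun z : PrefAlgClosure Lv U.K => ‖(z : U.K)‖) hxy
    simpa using this
  nlinarith [norm_nonneg (x : U.K), norm_nonneg (y : U.K)]

end Integers

end Summit.ABC.IUTFork.Joshi.Rosetta

end
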